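import Summits.CriticalPhenomena.PercolationContinuityZ3.Theorems.PercNearOneGluingNoHeavyQuantTreeRowFloorThreshold
import HarnessLib

/-!
# QUANT lane R8: the floor-resolved tree row `LawDec.TreeBuiltRowFloor` HOLDS whenever the top is at most `2j`
# (the law-level Markov half; every floor, every law — no tree structure needed)

builds on p205010 (kernel theorem, internal audit signed; external expert review pending)

Support file (`--supports stmt-CriticalPhenomena-4575`), QUANT lane typer seat prim-quant-stmt (gen 37), rung R8 of
`run/shared/lean/prim/quant/LADDER.md`; memo `run/shared/lean/prim/quant/prim-quant-stmt-g37/FLOORROW-G37.md`.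

Typer g36's conjecture `LawDec.TreeBuiltRowFloor` (`…QuantTreeRowFloorThreshold.lean`): every tree-built count law `μ` on `{0..M}`
at floor `x` with `(1 + x)·j < mean μ` has `x ≤ μ{j+1..M}`; its threshold `(1 + x)·j` is kernel-sharp at every floor through the
two-block family (two glued `j`-blocks behind gates `1⁻` and `x`), which has `M = 2j`.  THIS FILE: for ANY probability law `μ ≥ 0`
of mass one on `{0..M}` with `M ≤ 2j` and any `x ≥ 0`, `(1 + x)·j < mean ⟹ x < μ{j+1..M}` (`LawDec.tail_gt_floor_of_top_le_two_mul`):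
Markov's inequality for the nonnegative defect `M − N`, `(M − j)·μ{0..j} ≤ M − mean` (`LawDec.top_sub_level_mul_lowMass_le`), and
`M − (1 + x) j ≤ (1 − x)(M − j)` exactly when `x·M ≤ 2x·j`.  Hence `TreeBuiltRowFloor` restricted to `M ≤ 2j`
(`LawDec.treeBuiltRowFloor_of_top_le_two_mul`) — the regime containing the sharpness family — is a theorem, and the conjecture's
content is the case of more than `2j` relays.  The block-star version (real weights, plus the heavy-floor transport half) is
`…QuantIndepBlobFloorRow.lean`.  HONEST STATUS: `TreeBuiltRowFloor`, `TreeBuiltFAR`, `Quant.FarTreeRow` remain OPEN; RATE class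
log\* and the honest sentence of `run/shared/lean/prim/quant/README.md` unchanged.  [this work]; the gluing rows served
[cite: KozmaNitzan2024, Conjecture 3 (p. 15)]; product measure [cite: Grimmett1999, §1.3 p. 10].
-/

noncomputable section

namespace Summit.CriticalPhenomena.PercolationContinuityZ3.Theorems

namespace Quant

open Finset

namespace LawDec

/-- **Markov for the defect `M − N`.**  For `μ ≥ 0` of mass one on `{0..M}` and `j < M`:
`(M − j) · μ{0..j} ≤ M − mean μ`. [this work] -/
theorem top_sub_level_mul_lowMass_le (M j : ℕ) (μ : ℕ → ℝ) (hμ0 : ∀ k, 0 ≤ μ k)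
    (hμ1 : ∑ h ∈ Finset.range (M + 1), μ h = 1) (hjM : j < M) :
    ((M : ℝ) - j) * ∑ h ∈ Finset.range (j + 1), μ h ≤ (M : ℝ) - ∑ h ∈ Finset.range (M + 1), (h : ℝ) * μ h := by
  -- `M − mean = ∑_{h ≤ M} (M − h) μ h`
  have hdef : (M : ℝ) - ∑ h ∈ Finset.range (M + 1), (h : ℝ) * μ h = ∑ h ∈ Finset.range (M + 1), ((M : ℝ) - h) * μ h := by
    have e : ∀ h ∈ Finset.range (M + 1), ((M : ℝ) - h) * μ h = (M : ℝ) * μ h - (h : ℝ) * μ h := fun h _ => by ring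
    rw [Finset.sum_congr rfl e, Finset.sum_sub_distrib, ← Finset.mul_sum, hμ1, mul_one]
  rw [hdef, ← Finset.sum_range_add_sum_Ico _ (show j + 1 ≤ M + 1 by omega), Finset.mul_sum]
  have h1 : ∑ h ∈ Finset.range (j + 1), ((M : ℝ) - j) * μ h ≤ ∑ h ∈ Finset.range (j + 1), ((M : ℝ) - h) * μ h := by
    refine Finset.sum_le_sum fun h hh => ?_
    rw [Finset.mem_range] at hh
    have : (h : ℝ) ≤ j := by exact_mod_cast Nat.lt_succ_iff.1 hh
    exact mul_le_mul_of_nonneg_right (by linarith) (hμ0 h)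
  have h2 : 0 ≤ ∑ h ∈ Finset.Ico (j + 1) (M + 1), ((M : ℝ) - h) * μ h := by
    refine Finset.sum_nonneg fun h hh => mul_nonneg ?_ (hμ0 h)
    rw [Finset.mem_Ico] at hh
    have : (h : ℝ) ≤ M := by exact_mod_cast Nat.lt_succ_iff.1 hh.2
    linarith
  linarith

/-- **The floor-resolved row for EVERY law with top `M ≤ 2j` (law-level Markov half).**  For `μ ≥ 0` of mass one on `{0..M}`,
`x ≥ 0`, and a layer `j` with `M ≤ 2j` and `(1 + x)·j < mean μ`: `x < μ{j+1..M}`.  (`(M − j)·(1 − μ{j+1..M}) ≤ M − mean <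
M − (1+x) j ≤ (1 − x)(M − j)`, the last step being `x·M ≤ 2x·j`; the hypotheses force `j < M`.) [this work] -/
theorem tail_gt_floor_of_top_le_two_mul (x : ℝ) (M j : ℕ) (μ : ℕ → ℝ) (hx : 0 ≤ x) (hμ0 : ∀ k, 0 ≤ μ k)
    (hμ1 : ∑ h ∈ Finset.range (M + 1), μ h = 1) (hM : M ≤ 2 * j)
    (hmean : (1 + x) * (j : ℝ) < ∑ h ∈ Finset.range (M + 1), (h : ℝ) * μ h) :
    x < ∑ h ∈ Finset.Ico (j + 1) (M + 1), μ h := by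
  -- the mean is at most `M`
  have hmeanM : ∑ h ∈ Finset.range (M + 1), (h : ℝ) * μ h ≤ M := by
    calc ∑ h ∈ Finset.range (M + 1), (h : ℝ) * μ h ≤ ∑ h ∈ Finset.range (M + 1), (M : ℝ) * μ h := by
          refine Finset.sum_le_sum fun h hh => ?_
          rw [Finset.mem_range] at hh
          have : (h : ℝ) ≤ M := by exact_mod_cast Nat.lt_succ_iff.1 hh
          exact mul_le_mul_of_nonneg_right this (hμ0 h)
      _ = M := by rw [← Finset.mul_sum, hμ1, mul_one]
  -- hence `j < M`
  have hjM : j < M := by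
    by_contra hcon
    have hMj : (M : ℝ) ≤ j := by exact_mod_cast not_lt.1 hcon
    have hj0 : (0 : ℝ) ≤ j := Nat.cast_nonneg j
    nlinarith
  have hmark := top_sub_level_mul_lowMass_le M j μ hμ0 hμ1 hjM
  -- `μ{0..j} + μ{j+1..M} = 1`
  have hsplit : ∑ h ∈ Finset.range (j + 1), μ h + ∑ h ∈ Finset.Ico (j + 1) (M + 1), μ h = 1 := by
    rw [Finset.sum_range_add_sum_Ico _ (show j + 1 ≤ M + 1 by omega), hμ1]
  have hMj : (0 : ℝ) < (M : ℝ) - j := by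
    have : (j : ℝ) < M := by exact_mod_cast hjM
    linarith
  have hM' : (M : ℝ) ≤ 2 * j := by exact_mod_cast hM
  -- `M − (1+x) j ≤ (1 − x)(M − j)` iff `x M ≤ 2 x j`
  have hkey : ((M : ℝ) - j) * ∑ h ∈ Finset.range (j + 1), μ h < (1 - x) * ((M : ℝ) - j) := by
    have : x * (M : ℝ) ≤ x * (2 * j) := mul_le_mul_of_nonneg_left hM' hx
    nlinarith
  by_contra hcon
  push Not at hcon
  nlinarith

/-- **`LawDec.TreeBuiltRowFloor` HOLDS for every tree-built law with at most `2j` relays** (`M ≤ 2j`): the regime of the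
sharpness family of `treeBuiltRowFloor_threshold_sharp`.  Only the law facts of a tree-built law (floor `> 0`, `μ ≥ 0`, mass one;
`treeBuilt_lawFacts`) are used. [this work] -/
theorem treeBuiltRowFloor_of_top_le_two_mul {x : ℝ} {M : ℕ} {μ : ℕ → ℝ} (hμ : TreeBuilt x M μ) (j : ℕ) (hM : M ≤ 2 * j)
    (hmean : (1 + x) * (j : ℝ) < ∑ h ∈ Finset.range (M + 1), (h : ℝ) * μ h) :
    x ≤ ∑ h ∈ Finset.Ico (j + 1) (M + 1), μ h := by
  obtain ⟨hx0, -, hμ0, -, hμ1, -⟩ := treeBuilt_lawFacts hμ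
  exact (tail_gt_floor_of_top_le_two_mul x M j μ hx0.le hμ0 hμ1 hM hmean).le

/-- **The conjecture reduces to the many-relay case**: `TreeBuiltRowFloor` is equivalent to its restriction to laws with more than
`2j` relays. [this work] -/
theorem treeBuiltRowFloor_iff_many_relays :
    TreeBuiltRowFloor ↔
      ∀ (x : ℝ) (M : ℕ) (μ : ℕ → ℝ), TreeBuilt x M μ → ∀ j : ℕ, 2 * j < M →
        (1 + x) * (j : ℝ) < ∑ h ∈ Finset.range (M + 1), (h : ℝ) * μ h → x ≤ ∑ h ∈ Finset.Ico (j + 1) (M + 1), μ h := by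
  constructor
  · intro H x M μ hμ j _ hmean
    exact H x M μ hμ j hmean
  · intro H x M μ hμ j hmean
    by_cases hM : M ≤ 2 * j
    · exact treeBuiltRowFloor_of_top_le_two_mul hμ j hM hmean
    · exact H x M μ hμ j (lt_of_not_ge hM) hmean

end LawDec

end Quant

end Summit.CriticalPhenomena.PercolationContinuityZ3.Theorems
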